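import Summits.AtomisticToContinuum.HydrodynamicLimit.Theorems.OneFlightGossipEngineUniformLocalGibbsConcentration

/-!
# Route TwoClocks — the rev-10 `Assembly` frame (stmt-AtomisticToContinuum-16626) IS crux 11, unconditionally

Companion of `TwoClocksAssemblyReductions.lean` (which records `TransferEntropyClock → Assembly` and
`UniformLocalGibbsConcentration → Assembly → TransferEntropyClock` without importing another route's
module): here the static antecedent `UniformLocalGibbsConcentration` (closed item
stmt-AtomisticToContinuum-14445) is discharged by the tree's theorem
`twoClocks_uniformLocalGibbsConcentration_proof`, and `HsEosLowDensity` (closed item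
stmt-AtomisticToContinuum-0768) by the route file's `HsEosLowDensity_holds`, so that
`Assembly → TransferEntropyClock` holds outright. With `twoClocksAssembly_of_transferEntropyClock`
the assembly item stmt-16626 and crux 11 stmt-16625 are logically equivalent: whoever proves one
closes the other in one line. Kept in its own file because the discharge imports the
`OneFlightGossipEngine` route module (through the shared proof file of stmt-14445).
-/

namespace Summit.AtomisticToContinuum.HydrodynamicLimit.Theorems

open Summit.AtomisticToContinuum.HydrodynamicLimit.Theses.TwoClocks

/-- **The frame closes crux 11, unconditionally.** `Assembly → TransferEntropyClock`: feed the clock's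
five inputs to the frame together with the two PROVED statics
`twoClocks_uniformLocalGibbsConcentration_proof : UniformLocalGibbsConcentration` and
`HsEosLowDensity_holds : HsEosLowDensity` (note the swapped order of the two tail inputs).
[folklore] -/
theorem transferEntropyClock_of_twoClocksAssembly' (hA : Assembly) : TransferEntropyClock := by
  unfold TransferEntropyClock
  intro hK h₃ h₇ h₆ hS
  exact hA hK h₃ h₆ h₇ twoClocks_uniformLocalGibbsConcentration_proof HsEosLowDensity_holds hS

/-- **The assembly frame IS crux 11** (one citable equivalence). `Assembly ↔ TransferEntropyClock`
(stmt-AtomisticToContinuum-16626 ↔ stmt-AtomisticToContinuum-16625), unconditionally: `→` is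
`transferEntropyClock_of_twoClocksAssembly'` (the two static antecedents discharged by the PROVED
`twoClocks_uniformLocalGibbsConcentration_proof` and `HsEosLowDensity_holds`); `←` feeds the clock its five inputs
and discards the statics (the planner's weakening term, cf. `twoClocksAssembly_of_transferEntropyClock` in
`TwoClocksAssemblyReductions.lean`, restated inline so that this file keeps its single import). Consequence for
the ledger: the two items are one logical slot — a proof (or an ex-falso closure through a refuted antecedent) of
either closes the other in one line, and neither has content beyond Yau's macroscopic clock. [folklore] -/
theorem twoClocksAssembly_iff_transferEntropyClock : Assembly ↔ TransferEntropyClock := by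
  refine ⟨transferEntropyClock_of_twoClocksAssembly', fun hC => ?_⟩
  unfold Assembly
  intro hK h₃ h₆ h₇ _ _ hS
  exact hC hK h₃ h₇ h₆ hS

/-- The negated form, for refuters and planners: the frame fails exactly when the clock fails, i.e. (the clock
being weaker than the Statement) only together with `¬ HydrodynamicLimit`. [folklore] -/
theorem not_twoClocksAssembly_iff_not_transferEntropyClock : ¬ Assembly ↔ ¬ TransferEntropyClock :=
  not_congr twoClocksAssembly_iff_transferEntropyClock

end Summit.AtomisticToContinuum.HydrodynamicLimit.Theorems
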